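import Summits.ValiantsHypothesis.ValiantsHypothesis.Theorems.LacunarySymmetroidMatrixDescartesCensusFlankRow

/-!
# `MatrixDescartes` census — W4 boundary layer: the GRAM-BLOCK RESIDUAL KILL of the two-ended edges `x..17` (chamber 1706)

HONEST FRAMING.  Object-search cell `pub-symmetroid`, item `DoorA26 = PosRootLawAt 2 6 19` (stmt-ValiantsHypothesis-19979, OPEN,
typed, never asserted).  The W4 line (notes TROPFAN-W4-E1G17, CAPACITY09-E1G18, TWOROW-E1G19, W4-E1G20, O9-E1G22, RESIST518–520)
studies the DEGENERATIONS of HYPOTHETICAL Descartes-sharp symmetric `2 × 2` six-term pencils on the V = 20 open-core supports of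
chamber 1706 (pair-sum order of `(0,2,3,7,16,27)`).  After those notes every channel lies in one of the 63 faces
`T ⊆ {1,2,3,17,18,19}` of the cone `C₈`, decided by the 15 boundary long edges `x..y` — «out of reach of row methods» (TWOROW §7).
This file is the FIRST kill on that layer (seat note GRAMBLOCK-E2G26, engine-2 g26): on the two-ended edges `x..17` (`x = 0,1,2,3`)
the hull-edge form in ZP normal form is `F = A·C − B²`, `A = a₀ + a₁X^{d₁} + a₂X^{d₂}`, `B = [b₀ +] b₁X^{d₁} + ⋯ + b₄X^{d₄}`,
`C = [c₀ + ⋯ +] c_xX^{d_x} + ⋯ + c₅X^{d₅}` (`#terms = 18 − x`), and the positions `2d₃, d₃+d₄, 2d₄` carry ONLY the B-Gram block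
`−b₃², −2b₃b₄, −b₄²`.  Killing the other `#terms − 3` exponents by Euler twists (`countP_posRoots_le_countP_twists`, ≤ 1 root each)
leaves `−(M₃₃ b₃² X^{2d₃} + 2M₃₄ b₃b₄ X^{d₃+d₄} + M₄₄ b₄² X^{2d₄})` with INTEGER multipliers; when `M₃₄² < M₃₃M₄₄` this definite
binary form in `(b₃X^{d₃}, b₄X^{d₄})` has NO positive root (`countP_posRoots_gramBlock_eq_zero`; for `b₃ = b₄ = 0` it is the zero
polynomial, whose root multiset is empty), so `#Z₊^{mult}(F) ≤ #terms − 3 < #terms − 1`: the channel is dead.  NO SIGN HYPOTHESIS on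
any letter.  The inequality is support-level (46 / 52 / 62 / 64 of the 115 core supports for `x = 0 / 1 / 2 / 3`); here it is the
hypothesis `hdef`, discharged per support in `…CensusGramBlockBoundaryRows` by `decide`.  Mirror (edges `3..(20−x)`, chamber 954)
by `d ↦ −d` bookkeeping, not typed.  Nothing here bounds `ζ_sym(2,6)`, decides `DoorA26`, or bears on `MatrixDescartes`
(stmt-ValiantsHypothesis-18050) / `VP ≠ VNP`: a dead channel is a statement about hypothetical objects.

[folklore] Rolle with multiplicity (Euler twists) + definiteness of a binary quadratic form; no single source.
-/

-- `Summit.ValiantsHypothesis.ValiantsHypothesis.…` repeats a component by the D-0017 layout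
-- (single-conjunct summit), which the `dupNamespace` linter flags; the name is mandated.
set_option linter.dupNamespace false

namespace Summit.ValiantsHypothesis.ValiantsHypothesis.Theorems.LacunarySymmetroidMatrixDescartes.Census

open Polynomial Finset
open scoped BigOperators Polynomial

/-! ### A definite B-Gram block on the moment curve has no positive root -/

/-- **Residual lemma.**  For reals `b₃, b₄, P, Q, R` with `Q·Q < P·R` (the symmetric matrix `[[P,Q],[Q,R]]` is definite) and
exponents `i, j`, the trinomial `−(b₃²·P) X^{2i} − (2b₃b₄·Q) X^{i+j} − (b₄²·R) X^{2j}` has no positive root (counted with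
multiplicity): at a positive root, `P u² + 2Q uv + R v² = 0` with `u = b₃x^i`, `v = b₄x^j` forces `u = v = 0`, i.e. `b₃ = b₄ = 0`,
and then the polynomial is `0`, whose root multiset is empty. [folklore] -/
theorem countP_posRoots_gramBlock_eq_zero (b₃ b₄ P Q R : ℝ) (hdef : Q * Q < P * R) (i j : ℕ) :
    ((C (-(b₃ ^ 2) * P) * X ^ (2 * i) + C (-(b₃ * b₄ + b₃ * b₄) * Q) * X ^ (i + j)
        + C (-(b₄ ^ 2) * R) * X ^ (2 * j) : ℝ[X]).roots.countP (fun x => 0 < x)) = 0 := by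
  classical
  set p : ℝ[X] := C (-(b₃ ^ 2) * P) * X ^ (2 * i) + C (-(b₃ * b₄ + b₃ * b₄) * Q) * X ^ (i + j)
    + C (-(b₄ ^ 2) * R) * X ^ (2 * j) with hp_def
  by_cases hp : p = 0
  · rw [hp, roots_zero]; simp
  rw [Multiset.countP_eq_zero]
  intro x hx hx0
  rw [mem_roots hp] at hx
  have hx' : p.eval x = 0 := hx
  have hev : p.eval x = -(P * (b₃ * x ^ i) ^ 2 + 2 * Q * ((b₃ * x ^ i) * (b₄ * x ^ j)) + R * (b₄ * x ^ j) ^ 2) := by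
    rw [hp_def]
    simp only [eval_add, eval_mul, eval_C, eval_pow, eval_X]
    ring
  rw [hev, neg_eq_zero] at hx'
  have hPR : 0 < P * R - Q * Q := sub_pos.2 hdef
  have key1 : (P * (b₃ * x ^ i) + Q * (b₄ * x ^ j)) ^ 2 + (P * R - Q * Q) * (b₄ * x ^ j) ^ 2
      = P * (P * (b₃ * x ^ i) ^ 2 + 2 * Q * ((b₃ * x ^ i) * (b₄ * x ^ j)) + R * (b₄ * x ^ j) ^ 2) := by ring
  have key2 : (Q * (b₃ * x ^ i) + R * (b₄ * x ^ j)) ^ 2 + (P * R - Q * Q) * (b₃ * x ^ i) ^ 2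
      = R * (P * (b₃ * x ^ i) ^ 2 + 2 * Q * ((b₃ * x ^ i) * (b₄ * x ^ j)) + R * (b₄ * x ^ j) ^ 2) := by ring
  rw [hx', mul_zero] at key1 key2
  have hv2 : (b₄ * x ^ j) ^ 2 = 0 := by
    nlinarith [sq_nonneg (P * (b₃ * x ^ i) + Q * (b₄ * x ^ j)), mul_nonneg hPR.le (sq_nonneg (b₄ * x ^ j))]
  have hu2 : (b₃ * x ^ i) ^ 2 = 0 := by
    nlinarith [sq_nonneg (Q * (b₃ * x ^ i) + R * (b₄ * x ^ j)), mul_nonneg hPR.le (sq_nonneg (b₃ * x ^ i))]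
  have hv0 : b₄ * x ^ j = 0 := (pow_eq_zero_iff two_ne_zero).mp hv2
  have hu0 : b₃ * x ^ i = 0 := (pow_eq_zero_iff two_ne_zero).mp hu2
  have hb3 : b₃ = 0 := by
    rcases mul_eq_zero.mp hu0 with h | h
    · exact h
    · exact absurd h (pow_ne_zero _ hx0.ne')
  have hb4 : b₄ = 0 := by
    rcases mul_eq_zero.mp hv0 with h | h
    · exact h
    · exact absurd h (pow_ne_zero _ hx0.ne')
  apply hp
  rw [hp_def, hb3, hb4]
  simp

/-! ### The four two-ended boundary edges `x..17` of chamber 1706 -/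

/-- **THEOREM GB, edge `3..17`** (Gram-block residual kill, chamber 1706 normal form; sign-free).  For all exponents
`d₁ … d₅ : ℕ` and ALL real letters, if the twist-multiplier matrix of the alone B-Gram block `{b₃², b₃b₄, b₄²}` (positions
`2d₃, d₃+d₄, 2d₄`; the other 12 edge exponents killed) is definite — the integer hypothesis `hdef : M₃₄·M₃₄ < M₃₃·M₄₄` —
then the 15-term edge form `F = A·C − B²` of `ZP(3..17)` has at most `12 = #terms − 3 < 14 = #terms − 1` positive roots
with multiplicity: the edge is DEAD on every support satisfying `hdef` (64 / 115 core supports; rows file). [folklore] -/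
theorem countP_posRoots_zp_3_17_le (d₁ d₂ d₃ d₄ d₅ : ℕ) (a₀ a₁ a₂ c₃ c₄ c₅ b₁ b₂ b₃ b₄ : ℝ)
    (hdef : ((((d₃:ℤ) + d₄) - (d₃:ℤ)) * (((d₃:ℤ) + d₄) - (d₄:ℤ)) * (((d₃:ℤ) + d₄) - (d₅:ℤ)) *
        (((d₃:ℤ) + d₄) - 2 * (d₁:ℤ)) * (((d₃:ℤ) + d₄) - ((d₁:ℤ) + d₂)) * (((d₃:ℤ) + d₄) - ((d₁:ℤ) + d₃)) *
        (((d₃:ℤ) + d₄) - ((d₁:ℤ) + d₄)) * (((d₃:ℤ) + d₄) - ((d₁:ℤ) + d₅)) * (((d₃:ℤ) + d₄) - 2 * (d₂:ℤ)) *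
        (((d₃:ℤ) + d₄) - ((d₂:ℤ) + d₃)) * (((d₃:ℤ) + d₄) - ((d₂:ℤ) + d₄)) * (((d₃:ℤ) + d₄) - ((d₂:ℤ) + d₅)))
      * ((((d₃:ℤ) + d₄) - (d₃:ℤ)) * (((d₃:ℤ) + d₄) - (d₄:ℤ)) * (((d₃:ℤ) + d₄) - (d₅:ℤ)) *
        (((d₃:ℤ) + d₄) - 2 * (d₁:ℤ)) * (((d₃:ℤ) + d₄) - ((d₁:ℤ) + d₂)) * (((d₃:ℤ) + d₄) - ((d₁:ℤ) + d₃)) *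
        (((d₃:ℤ) + d₄) - ((d₁:ℤ) + d₄)) * (((d₃:ℤ) + d₄) - ((d₁:ℤ) + d₅)) * (((d₃:ℤ) + d₄) - 2 * (d₂:ℤ)) *
        (((d₃:ℤ) + d₄) - ((d₂:ℤ) + d₃)) * (((d₃:ℤ) + d₄) - ((d₂:ℤ) + d₄)) * (((d₃:ℤ) + d₄) - ((d₂:ℤ) + d₅)))
      < ((2 * (d₃:ℤ) - (d₃:ℤ)) * (2 * (d₃:ℤ) - (d₄:ℤ)) * (2 * (d₃:ℤ) - (d₅:ℤ)) * (2 * (d₃:ℤ) - 2 * (d₁:ℤ)) *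
        (2 * (d₃:ℤ) - ((d₁:ℤ) + d₂)) * (2 * (d₃:ℤ) - ((d₁:ℤ) + d₃)) * (2 * (d₃:ℤ) - ((d₁:ℤ) + d₄)) *
        (2 * (d₃:ℤ) - ((d₁:ℤ) + d₅)) * (2 * (d₃:ℤ) - 2 * (d₂:ℤ)) * (2 * (d₃:ℤ) - ((d₂:ℤ) + d₃)) *
        (2 * (d₃:ℤ) - ((d₂:ℤ) + d₄)) * (2 * (d₃:ℤ) - ((d₂:ℤ) + d₅)))
      * ((2 * (d₄:ℤ) - (d₃:ℤ)) * (2 * (d₄:ℤ) - (d₄:ℤ)) * (2 * (d₄:ℤ) - (d₅:ℤ)) * (2 * (d₄:ℤ) - 2 * (d₁:ℤ)) *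
        (2 * (d₄:ℤ) - ((d₁:ℤ) + d₂)) * (2 * (d₄:ℤ) - ((d₁:ℤ) + d₃)) * (2 * (d₄:ℤ) - ((d₁:ℤ) + d₄)) *
        (2 * (d₄:ℤ) - ((d₁:ℤ) + d₅)) * (2 * (d₄:ℤ) - 2 * (d₂:ℤ)) * (2 * (d₄:ℤ) - ((d₂:ℤ) + d₃)) *
        (2 * (d₄:ℤ) - ((d₂:ℤ) + d₄)) * (2 * (d₄:ℤ) - ((d₂:ℤ) + d₅)))) :
    (((C a₀ + C a₁ * X ^ d₁ + C a₂ * X ^ d₂) * (C c₃ * X ^ d₃ + C c₄ * X ^ d₄ + C c₅ * X ^ d₅)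
        - (C b₁ * X ^ d₁ + C b₂ * X ^ d₂ + C b₃ * X ^ d₃ + C b₄ * X ^ d₄) ^ 2 : ℝ[X]).roots.countP (fun x => 0 < x)) ≤ 12 := by
  classical
  set e : ℕ → ℕ := fun t => match t with
    | 0 => 2 * d₃ | 1 => d₃ + d₄ | 2 => 2 * d₄ | 3 => d₃ | 4 => d₄ | 5 => d₅ | 6 => 2 * d₁ | 7 => d₁ + d₂
    | 8 => d₁ + d₃ | 9 => d₁ + d₄ | 10 => d₁ + d₅ | 11 => 2 * d₂ | 12 => d₂ + d₃ | 13 => d₂ + d₄ | 14 => d₂ + d₅ | _ => 0 with he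
  set c : ℕ → ℝ := fun t => match t with
    | 0 => -(b₃ ^ 2) | 1 => -((b₃ * b₄ + b₃ * b₄)) | 2 => -(b₄ ^ 2) | 3 => a₀ * c₃ | 4 => a₀ * c₄ | 5 => a₀ * c₅
    | 6 => -(b₁ ^ 2) | 7 => -((b₁ * b₂ + b₁ * b₂)) | 8 => a₁ * c₃ - (b₁ * b₃ + b₁ * b₃)
    | 9 => a₁ * c₄ - (b₁ * b₄ + b₁ * b₄) | 10 => a₁ * c₅ | 11 => -(b₂ ^ 2) | 12 => a₂ * c₃ - (b₂ * b₃ + b₂ * b₃)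
    | 13 => a₂ * c₄ - (b₂ * b₄ + b₂ * b₄) | 14 => a₂ * c₅ | _ => 0 with hc
  have hF : ((C a₀ + C a₁ * X ^ d₁ + C a₂ * X ^ d₂) * (C c₃ * X ^ d₃ + C c₄ * X ^ d₄ + C c₅ * X ^ d₅)
        - (C b₁ * X ^ d₁ + C b₂ * X ^ d₂ + C b₃ * X ^ d₃ + C b₄ * X ^ d₄) ^ 2 : ℝ[X])
      = ∑ t ∈ range 15, C (c t) * X ^ (e t) := by
    simp only [Finset.sum_range_succ, Finset.sum_range_zero, zero_add, he, hc, map_mul, map_neg, map_sub,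
      map_pow, map_add, pow_add, two_mul]
    ring
  rw [hF]
  have step := countP_posRoots_le_countP_twists 15 e c (Ico 3 15)
  have hcard : (Ico 3 15).card = 12 := by simp
  rw [hcard] at step
  obtain ⟨M, hM⟩ : ∃ M : ℕ → ℝ, ∀ t, M t = ∏ u ∈ Ico 3 15, ((e t : ℝ) - e u) := ⟨_, fun _ => rfl⟩
  have hres : (∑ t ∈ range 15, C (c t * ∏ u ∈ Ico 3 15, ((e t : ℝ) - e u)) * X ^ (e t) : ℝ[X])
      = C (c 0 * M 0) * X ^ (e 0) + C (c 1 * M 1) * X ^ (e 1) + C (c 2 * M 2) * X ^ (e 2) := by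
    rw [Finset.range_eq_Ico, ← Finset.sum_Ico_consecutive _ (show 0 ≤ 3 by norm_num) (show 3 ≤ 15 by norm_num)]
    have hz : (∑ t ∈ Ico 3 15, C (c t * ∏ u ∈ Ico 3 15, ((e t : ℝ) - e u)) * X ^ (e t) : ℝ[X]) = 0 := by
      refine Finset.sum_eq_zero fun t ht => ?_
      rw [Finset.prod_eq_zero ht (sub_self _), mul_zero, map_zero, zero_mul]
    rw [hz, add_zero, Nat.Ico_zero_eq_range]
    simp only [Finset.sum_range_succ, Finset.sum_range_zero, zero_add, ← hM]
  rw [hres] at step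
  have e0 : e 0 = 2 * d₃ := rfl; have e1 : e 1 = d₃ + d₄ := rfl; have e2 : e 2 = 2 * d₄ := rfl
  have c0 : c 0 = -(b₃ ^ 2) := rfl; have c1 : c 1 = -(b₃ * b₄ + b₃ * b₄) := rfl; have c2 : c 2 = -(b₄ ^ 2) := rfl
  rw [e0, e1, e2, c0, c1, c2] at step
  have unroll : ∀ t, M t = ((e t : ℝ) - e 3) * ((e t : ℝ) - e 4) * ((e t : ℝ) - e 5) * ((e t : ℝ) - e 6) *
      ((e t : ℝ) - e 7) * ((e t : ℝ) - e 8) * ((e t : ℝ) - e 9) * ((e t : ℝ) - e 10) * ((e t : ℝ) - e 11) *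
      ((e t : ℝ) - e 12) * ((e t : ℝ) - e 13) * ((e t : ℝ) - e 14) := by
    intro t
    rw [hM, Finset.prod_Ico_eq_prod_range]
    simp only [show (15 : ℕ) - 3 = 12 by norm_num, Finset.prod_range_succ, Finset.prod_range_zero, one_mul,
      Nat.reduceAdd]
  have K : M 1 * M 1 < M 0 * M 2 := by
    have h := (Int.cast_lt (R := ℝ)).mpr hdef
    push_cast at h
    simp only [unroll, he]
    push_cast
    exact h
  have res : ((C (-(b₃ ^ 2) * M 0) * X ^ (2 * d₃) + C (-(b₃ * b₄ + b₃ * b₄) * M 1) * X ^ (d₃ + d₄)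
      + C (-(b₄ ^ 2) * M 2) * X ^ (2 * d₄) : ℝ[X]).roots.countP (fun x => 0 < x)) = 0 :=
    countP_posRoots_gramBlock_eq_zero b₃ b₄ (M 0) (M 1) (M 2) K d₃ d₄
  omega

/-- **THEOREM GB, edge `2..17`** (Gram-block residual kill, chamber 1706 normal form; sign-free).  For all exponents
`d₁ … d₅ : ℕ` and ALL real letters, if the twist-multiplier matrix of the alone B-Gram block `{b₃², b₃b₄, b₄²}` (positions
`2d₃, d₃+d₄, 2d₄`; the other 13 edge exponents killed) is definite — the integer hypothesis `hdef : M₃₄·M₃₄ < M₃₃·M₄₄` —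
then the 16-term edge form `F = A·C − B²` of `ZP(2..17)` has at most `13 = #terms − 3 < 15 = #terms − 1` positive roots
with multiplicity: the edge is DEAD on every support satisfying `hdef` (62 / 115 core supports; rows file). [folklore] -/
theorem countP_posRoots_zp_2_17_le (d₁ d₂ d₃ d₄ d₅ : ℕ) (a₀ a₁ a₂ c₂ c₃ c₄ c₅ b₁ b₂ b₃ b₄ : ℝ)
    (hdef : ((((d₃:ℤ) + d₄) - (d₂:ℤ)) * (((d₃:ℤ) + d₄) - (d₃:ℤ)) * (((d₃:ℤ) + d₄) - (d₄:ℤ)) *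
        (((d₃:ℤ) + d₄) - (d₅:ℤ)) * (((d₃:ℤ) + d₄) - 2 * (d₁:ℤ)) * (((d₃:ℤ) + d₄) - ((d₁:ℤ) + d₂)) *
        (((d₃:ℤ) + d₄) - ((d₁:ℤ) + d₃)) * (((d₃:ℤ) + d₄) - ((d₁:ℤ) + d₄)) * (((d₃:ℤ) + d₄) - ((d₁:ℤ) + d₅)) *
        (((d₃:ℤ) + d₄) - 2 * (d₂:ℤ)) * (((d₃:ℤ) + d₄) - ((d₂:ℤ) + d₃)) * (((d₃:ℤ) + d₄) - ((d₂:ℤ) + d₄)) *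
        (((d₃:ℤ) + d₄) - ((d₂:ℤ) + d₅)))
      * ((((d₃:ℤ) + d₄) - (d₂:ℤ)) * (((d₃:ℤ) + d₄) - (d₃:ℤ)) * (((d₃:ℤ) + d₄) - (d₄:ℤ)) * (((d₃:ℤ) + d₄) - (d₅:ℤ)) *
        (((d₃:ℤ) + d₄) - 2 * (d₁:ℤ)) * (((d₃:ℤ) + d₄) - ((d₁:ℤ) + d₂)) * (((d₃:ℤ) + d₄) - ((d₁:ℤ) + d₃)) *
        (((d₃:ℤ) + d₄) - ((d₁:ℤ) + d₄)) * (((d₃:ℤ) + d₄) - ((d₁:ℤ) + d₅)) * (((d₃:ℤ) + d₄) - 2 * (d₂:ℤ)) *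
        (((d₃:ℤ) + d₄) - ((d₂:ℤ) + d₃)) * (((d₃:ℤ) + d₄) - ((d₂:ℤ) + d₄)) * (((d₃:ℤ) + d₄) - ((d₂:ℤ) + d₅)))
      < ((2 * (d₃:ℤ) - (d₂:ℤ)) * (2 * (d₃:ℤ) - (d₃:ℤ)) * (2 * (d₃:ℤ) - (d₄:ℤ)) * (2 * (d₃:ℤ) - (d₅:ℤ)) *
        (2 * (d₃:ℤ) - 2 * (d₁:ℤ)) * (2 * (d₃:ℤ) - ((d₁:ℤ) + d₂)) * (2 * (d₃:ℤ) - ((d₁:ℤ) + d₃)) *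
        (2 * (d₃:ℤ) - ((d₁:ℤ) + d₄)) * (2 * (d₃:ℤ) - ((d₁:ℤ) + d₅)) * (2 * (d₃:ℤ) - 2 * (d₂:ℤ)) *
        (2 * (d₃:ℤ) - ((d₂:ℤ) + d₃)) * (2 * (d₃:ℤ) - ((d₂:ℤ) + d₄)) * (2 * (d₃:ℤ) - ((d₂:ℤ) + d₅)))
      * ((2 * (d₄:ℤ) - (d₂:ℤ)) * (2 * (d₄:ℤ) - (d₃:ℤ)) * (2 * (d₄:ℤ) - (d₄:ℤ)) * (2 * (d₄:ℤ) - (d₅:ℤ)) *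
        (2 * (d₄:ℤ) - 2 * (d₁:ℤ)) * (2 * (d₄:ℤ) - ((d₁:ℤ) + d₂)) * (2 * (d₄:ℤ) - ((d₁:ℤ) + d₃)) *
        (2 * (d₄:ℤ) - ((d₁:ℤ) + d₄)) * (2 * (d₄:ℤ) - ((d₁:ℤ) + d₅)) * (2 * (d₄:ℤ) - 2 * (d₂:ℤ)) *
        (2 * (d₄:ℤ) - ((d₂:ℤ) + d₃)) * (2 * (d₄:ℤ) - ((d₂:ℤ) + d₄)) * (2 * (d₄:ℤ) - ((d₂:ℤ) + d₅)))) :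
    (((C a₀ + C a₁ * X ^ d₁ + C a₂ * X ^ d₂) * (C c₂ * X ^ d₂ + C c₃ * X ^ d₃ + C c₄ * X ^ d₄ + C c₅ * X ^ d₅)
        - (C b₁ * X ^ d₁ + C b₂ * X ^ d₂ + C b₃ * X ^ d₃ + C b₄ * X ^ d₄) ^ 2 : ℝ[X]).roots.countP (fun x => 0 < x)) ≤ 13 := by
  classical
  set e : ℕ → ℕ := fun t => match t with
    | 0 => 2 * d₃ | 1 => d₃ + d₄ | 2 => 2 * d₄ | 3 => d₂ | 4 => d₃ | 5 => d₄ | 6 => d₅ | 7 => 2 * d₁ | 8 => d₁ + d₂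
    | 9 => d₁ + d₃ | 10 => d₁ + d₄ | 11 => d₁ + d₅ | 12 => 2 * d₂ | 13 => d₂ + d₃ | 14 => d₂ + d₄ | 15 => d₂ + d₅ | _ => 0 with he
  set c : ℕ → ℝ := fun t => match t with
    | 0 => -(b₃ ^ 2) | 1 => -((b₃ * b₄ + b₃ * b₄)) | 2 => -(b₄ ^ 2) | 3 => a₀ * c₂ | 4 => a₀ * c₃ | 5 => a₀ * c₄
    | 6 => a₀ * c₅ | 7 => -(b₁ ^ 2) | 8 => a₁ * c₂ - (b₁ * b₂ + b₁ * b₂) | 9 => a₁ * c₃ - (b₁ * b₃ + b₁ * b₃)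
    | 10 => a₁ * c₄ - (b₁ * b₄ + b₁ * b₄) | 11 => a₁ * c₅ | 12 => a₂ * c₂ - b₂ ^ 2
    | 13 => a₂ * c₃ - (b₂ * b₃ + b₂ * b₃) | 14 => a₂ * c₄ - (b₂ * b₄ + b₂ * b₄) | 15 => a₂ * c₅ | _ => 0 with hc
  have hF : ((C a₀ + C a₁ * X ^ d₁ + C a₂ * X ^ d₂) * (C c₂ * X ^ d₂ + C c₃ * X ^ d₃ + C c₄ * X ^ d₄ + C c₅ * X ^ d₅)
        - (C b₁ * X ^ d₁ + C b₂ * X ^ d₂ + C b₃ * X ^ d₃ + C b₄ * X ^ d₄) ^ 2 : ℝ[X])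
      = ∑ t ∈ range 16, C (c t) * X ^ (e t) := by
    simp only [Finset.sum_range_succ, Finset.sum_range_zero, zero_add, he, hc, map_mul, map_neg, map_sub,
      map_pow, map_add, pow_add, two_mul]
    ring
  rw [hF]
  have step := countP_posRoots_le_countP_twists 16 e c (Ico 3 16)
  have hcard : (Ico 3 16).card = 13 := by simp
  rw [hcard] at step
  obtain ⟨M, hM⟩ : ∃ M : ℕ → ℝ, ∀ t, M t = ∏ u ∈ Ico 3 16, ((e t : ℝ) - e u) := ⟨_, fun _ => rfl⟩
  have hres : (∑ t ∈ range 16, C (c t * ∏ u ∈ Ico 3 16, ((e t : ℝ) - e u)) * X ^ (e t) : ℝ[X])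
      = C (c 0 * M 0) * X ^ (e 0) + C (c 1 * M 1) * X ^ (e 1) + C (c 2 * M 2) * X ^ (e 2) := by
    rw [Finset.range_eq_Ico, ← Finset.sum_Ico_consecutive _ (show 0 ≤ 3 by norm_num) (show 3 ≤ 16 by norm_num)]
    have hz : (∑ t ∈ Ico 3 16, C (c t * ∏ u ∈ Ico 3 16, ((e t : ℝ) - e u)) * X ^ (e t) : ℝ[X]) = 0 := by
      refine Finset.sum_eq_zero fun t ht => ?_
      rw [Finset.prod_eq_zero ht (sub_self _), mul_zero, map_zero, zero_mul]
    rw [hz, add_zero, Nat.Ico_zero_eq_range]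
    simp only [Finset.sum_range_succ, Finset.sum_range_zero, zero_add, ← hM]
  rw [hres] at step
  have e0 : e 0 = 2 * d₃ := rfl; have e1 : e 1 = d₃ + d₄ := rfl; have e2 : e 2 = 2 * d₄ := rfl
  have c0 : c 0 = -(b₃ ^ 2) := rfl; have c1 : c 1 = -(b₃ * b₄ + b₃ * b₄) := rfl; have c2 : c 2 = -(b₄ ^ 2) := rfl
  rw [e0, e1, e2, c0, c1, c2] at step
  have unroll : ∀ t, M t = ((e t : ℝ) - e 3) * ((e t : ℝ) - e 4) * ((e t : ℝ) - e 5) * ((e t : ℝ) - e 6) *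
      ((e t : ℝ) - e 7) * ((e t : ℝ) - e 8) * ((e t : ℝ) - e 9) * ((e t : ℝ) - e 10) * ((e t : ℝ) - e 11) *
      ((e t : ℝ) - e 12) * ((e t : ℝ) - e 13) * ((e t : ℝ) - e 14) * ((e t : ℝ) - e 15) := by
    intro t
    rw [hM, Finset.prod_Ico_eq_prod_range]
    simp only [show (16 : ℕ) - 3 = 13 by norm_num, Finset.prod_range_succ, Finset.prod_range_zero, one_mul,
      Nat.reduceAdd]
  have K : M 1 * M 1 < M 0 * M 2 := by
    have h := (Int.cast_lt (R := ℝ)).mpr hdef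
    push_cast at h
    simp only [unroll, he]
    push_cast
    exact h
  have res : ((C (-(b₃ ^ 2) * M 0) * X ^ (2 * d₃) + C (-(b₃ * b₄ + b₃ * b₄) * M 1) * X ^ (d₃ + d₄)
      + C (-(b₄ ^ 2) * M 2) * X ^ (2 * d₄) : ℝ[X]).roots.countP (fun x => 0 < x)) = 0 :=
    countP_posRoots_gramBlock_eq_zero b₃ b₄ (M 0) (M 1) (M 2) K d₃ d₄
  omega

/-- **THEOREM GB, edge `1..17`** (Gram-block residual kill, chamber 1706 normal form; sign-free).  For all exponents
`d₁ … d₅ : ℕ` and ALL real letters, if the twist-multiplier matrix of the alone B-Gram block `{b₃², b₃b₄, b₄²}` (positions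
`2d₃, d₃+d₄, 2d₄`; the other 14 edge exponents killed) is definite — the integer hypothesis `hdef : M₃₄·M₃₄ < M₃₃·M₄₄` —
then the 17-term edge form `F = A·C − B²` of `ZP(1..17)` has at most `14 = #terms − 3 < 16 = #terms − 1` positive roots
with multiplicity: the edge is DEAD on every support satisfying `hdef` (52 / 115 core supports; rows file). [folklore] -/
theorem countP_posRoots_zp_1_17_le (d₁ d₂ d₃ d₄ d₅ : ℕ) (a₀ a₁ a₂ c₁ c₂ c₃ c₄ c₅ b₁ b₂ b₃ b₄ : ℝ)
    (hdef : ((((d₃:ℤ) + d₄) - (d₁:ℤ)) * (((d₃:ℤ) + d₄) - (d₂:ℤ)) * (((d₃:ℤ) + d₄) - (d₃:ℤ)) *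
        (((d₃:ℤ) + d₄) - (d₄:ℤ)) * (((d₃:ℤ) + d₄) - (d₅:ℤ)) * (((d₃:ℤ) + d₄) - 2 * (d₁:ℤ)) *
        (((d₃:ℤ) + d₄) - ((d₁:ℤ) + d₂)) * (((d₃:ℤ) + d₄) - ((d₁:ℤ) + d₃)) * (((d₃:ℤ) + d₄) - ((d₁:ℤ) + d₄)) *
        (((d₃:ℤ) + d₄) - ((d₁:ℤ) + d₅)) * (((d₃:ℤ) + d₄) - 2 * (d₂:ℤ)) * (((d₃:ℤ) + d₄) - ((d₂:ℤ) + d₃)) *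
        (((d₃:ℤ) + d₄) - ((d₂:ℤ) + d₄)) * (((d₃:ℤ) + d₄) - ((d₂:ℤ) + d₅)))
      * ((((d₃:ℤ) + d₄) - (d₁:ℤ)) * (((d₃:ℤ) + d₄) - (d₂:ℤ)) * (((d₃:ℤ) + d₄) - (d₃:ℤ)) * (((d₃:ℤ) + d₄) - (d₄:ℤ)) *
        (((d₃:ℤ) + d₄) - (d₅:ℤ)) * (((d₃:ℤ) + d₄) - 2 * (d₁:ℤ)) * (((d₃:ℤ) + d₄) - ((d₁:ℤ) + d₂)) *
        (((d₃:ℤ) + d₄) - ((d₁:ℤ) + d₃)) * (((d₃:ℤ) + d₄) - ((d₁:ℤ) + d₄)) * (((d₃:ℤ) + d₄) - ((d₁:ℤ) + d₅)) *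
        (((d₃:ℤ) + d₄) - 2 * (d₂:ℤ)) * (((d₃:ℤ) + d₄) - ((d₂:ℤ) + d₃)) * (((d₃:ℤ) + d₄) - ((d₂:ℤ) + d₄)) *
        (((d₃:ℤ) + d₄) - ((d₂:ℤ) + d₅)))
      < ((2 * (d₃:ℤ) - (d₁:ℤ)) * (2 * (d₃:ℤ) - (d₂:ℤ)) * (2 * (d₃:ℤ) - (d₃:ℤ)) * (2 * (d₃:ℤ) - (d₄:ℤ)) *
        (2 * (d₃:ℤ) - (d₅:ℤ)) * (2 * (d₃:ℤ) - 2 * (d₁:ℤ)) * (2 * (d₃:ℤ) - ((d₁:ℤ) + d₂)) *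
        (2 * (d₃:ℤ) - ((d₁:ℤ) + d₃)) * (2 * (d₃:ℤ) - ((d₁:ℤ) + d₄)) * (2 * (d₃:ℤ) - ((d₁:ℤ) + d₅)) *
        (2 * (d₃:ℤ) - 2 * (d₂:ℤ)) * (2 * (d₃:ℤ) - ((d₂:ℤ) + d₃)) * (2 * (d₃:ℤ) - ((d₂:ℤ) + d₄)) *
        (2 * (d₃:ℤ) - ((d₂:ℤ) + d₅)))
      * ((2 * (d₄:ℤ) - (d₁:ℤ)) * (2 * (d₄:ℤ) - (d₂:ℤ)) * (2 * (d₄:ℤ) - (d₃:ℤ)) * (2 * (d₄:ℤ) - (d₄:ℤ)) *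
        (2 * (d₄:ℤ) - (d₅:ℤ)) * (2 * (d₄:ℤ) - 2 * (d₁:ℤ)) * (2 * (d₄:ℤ) - ((d₁:ℤ) + d₂)) *
        (2 * (d₄:ℤ) - ((d₁:ℤ) + d₃)) * (2 * (d₄:ℤ) - ((d₁:ℤ) + d₄)) * (2 * (d₄:ℤ) - ((d₁:ℤ) + d₅)) *
        (2 * (d₄:ℤ) - 2 * (d₂:ℤ)) * (2 * (d₄:ℤ) - ((d₂:ℤ) + d₃)) * (2 * (d₄:ℤ) - ((d₂:ℤ) + d₄)) *
        (2 * (d₄:ℤ) - ((d₂:ℤ) + d₅)))) :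
    (((C a₀ + C a₁ * X ^ d₁ + C a₂ * X ^ d₂) * (C c₁ * X ^ d₁ + C c₂ * X ^ d₂ + C c₃ * X ^ d₃ + C c₄ * X ^ d₄ + C c₅ * X ^ d₅)
        - (C b₁ * X ^ d₁ + C b₂ * X ^ d₂ + C b₃ * X ^ d₃ + C b₄ * X ^ d₄) ^ 2 : ℝ[X]).roots.countP (fun x => 0 < x)) ≤ 14 := by
  classical
  set e : ℕ → ℕ := fun t => match t with
    | 0 => 2 * d₃ | 1 => d₃ + d₄ | 2 => 2 * d₄ | 3 => d₁ | 4 => d₂ | 5 => d₃ | 6 => d₄ | 7 => d₅ | 8 => 2 * d₁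
    | 9 => d₁ + d₂ | 10 => d₁ + d₃ | 11 => d₁ + d₄ | 12 => d₁ + d₅ | 13 => 2 * d₂ | 14 => d₂ + d₃ | 15 => d₂ + d₄
    | 16 => d₂ + d₅ | _ => 0 with he
  set c : ℕ → ℝ := fun t => match t with
    | 0 => -(b₃ ^ 2) | 1 => -((b₃ * b₄ + b₃ * b₄)) | 2 => -(b₄ ^ 2) | 3 => a₀ * c₁ | 4 => a₀ * c₂ | 5 => a₀ * c₃
    | 6 => a₀ * c₄ | 7 => a₀ * c₅ | 8 => a₁ * c₁ - b₁ ^ 2 | 9 => a₁ * c₂ + a₂ * c₁ - (b₁ * b₂ + b₁ * b₂)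
    | 10 => a₁ * c₃ - (b₁ * b₃ + b₁ * b₃) | 11 => a₁ * c₄ - (b₁ * b₄ + b₁ * b₄) | 12 => a₁ * c₅
    | 13 => a₂ * c₂ - b₂ ^ 2 | 14 => a₂ * c₃ - (b₂ * b₃ + b₂ * b₃) | 15 => a₂ * c₄ - (b₂ * b₄ + b₂ * b₄)
    | 16 => a₂ * c₅ | _ => 0 with hc
  have hF : ((C a₀ + C a₁ * X ^ d₁ + C a₂ * X ^ d₂) * (C c₁ * X ^ d₁ + C c₂ * X ^ d₂ + C c₃ * X ^ d₃ + C c₄ * X ^ d₄ + C c₅ * X ^ d₅)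
        - (C b₁ * X ^ d₁ + C b₂ * X ^ d₂ + C b₃ * X ^ d₃ + C b₄ * X ^ d₄) ^ 2 : ℝ[X])
      = ∑ t ∈ range 17, C (c t) * X ^ (e t) := by
    simp only [Finset.sum_range_succ, Finset.sum_range_zero, zero_add, he, hc, map_mul, map_neg, map_sub,
      map_pow, map_add, pow_add, two_mul]
    ring
  rw [hF]
  have step := countP_posRoots_le_countP_twists 17 e c (Ico 3 17)
  have hcard : (Ico 3 17).card = 14 := by simp
  rw [hcard] at step
  obtain ⟨M, hM⟩ : ∃ M : ℕ → ℝ, ∀ t, M t = ∏ u ∈ Ico 3 17, ((e t : ℝ) - e u) := ⟨_, fun _ => rfl⟩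
  have hres : (∑ t ∈ range 17, C (c t * ∏ u ∈ Ico 3 17, ((e t : ℝ) - e u)) * X ^ (e t) : ℝ[X])
      = C (c 0 * M 0) * X ^ (e 0) + C (c 1 * M 1) * X ^ (e 1) + C (c 2 * M 2) * X ^ (e 2) := by
    rw [Finset.range_eq_Ico, ← Finset.sum_Ico_consecutive _ (show 0 ≤ 3 by norm_num) (show 3 ≤ 17 by norm_num)]
    have hz : (∑ t ∈ Ico 3 17, C (c t * ∏ u ∈ Ico 3 17, ((e t : ℝ) - e u)) * X ^ (e t) : ℝ[X]) = 0 := by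
      refine Finset.sum_eq_zero fun t ht => ?_
      rw [Finset.prod_eq_zero ht (sub_self _), mul_zero, map_zero, zero_mul]
    rw [hz, add_zero, Nat.Ico_zero_eq_range]
    simp only [Finset.sum_range_succ, Finset.sum_range_zero, zero_add, ← hM]
  rw [hres] at step
  have e0 : e 0 = 2 * d₃ := rfl; have e1 : e 1 = d₃ + d₄ := rfl; have e2 : e 2 = 2 * d₄ := rfl
  have c0 : c 0 = -(b₃ ^ 2) := rfl; have c1 : c 1 = -(b₃ * b₄ + b₃ * b₄) := rfl; have c2 : c 2 = -(b₄ ^ 2) := rfl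
  rw [e0, e1, e2, c0, c1, c2] at step
  have unroll : ∀ t, M t = ((e t : ℝ) - e 3) * ((e t : ℝ) - e 4) * ((e t : ℝ) - e 5) * ((e t : ℝ) - e 6) *
      ((e t : ℝ) - e 7) * ((e t : ℝ) - e 8) * ((e t : ℝ) - e 9) * ((e t : ℝ) - e 10) * ((e t : ℝ) - e 11) *
      ((e t : ℝ) - e 12) * ((e t : ℝ) - e 13) * ((e t : ℝ) - e 14) * ((e t : ℝ) - e 15) * ((e t : ℝ) - e 16) := by
    intro t
    rw [hM, Finset.prod_Ico_eq_prod_range]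
    simp only [show (17 : ℕ) - 3 = 14 by norm_num, Finset.prod_range_succ, Finset.prod_range_zero, one_mul,
      Nat.reduceAdd]
  have K : M 1 * M 1 < M 0 * M 2 := by
    have h := (Int.cast_lt (R := ℝ)).mpr hdef
    push_cast at h
    simp only [unroll, he]
    push_cast
    exact h
  have res : ((C (-(b₃ ^ 2) * M 0) * X ^ (2 * d₃) + C (-(b₃ * b₄ + b₃ * b₄) * M 1) * X ^ (d₃ + d₄)
      + C (-(b₄ ^ 2) * M 2) * X ^ (2 * d₄) : ℝ[X]).roots.countP (fun x => 0 < x)) = 0 :=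
    countP_posRoots_gramBlock_eq_zero b₃ b₄ (M 0) (M 1) (M 2) K d₃ d₄
  omega

/-- **THEOREM GB, edge `0..17`** (Gram-block residual kill, chamber 1706 normal form; sign-free).  For all exponents
`d₁ … d₅ : ℕ` and ALL real letters, if the twist-multiplier matrix of the alone B-Gram block `{b₃², b₃b₄, b₄²}` (positions
`2d₃, d₃+d₄, 2d₄`; the other 15 edge exponents killed) is definite — the integer hypothesis `hdef : M₃₄·M₃₄ < M₃₃·M₄₄` —
then the 18-term edge form `F = A·C − B²` of `ZP(0..17)` has at most `15 = #terms − 3 < 17 = #terms − 1` positive roots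
with multiplicity: the edge is DEAD on every support satisfying `hdef` (46 / 115 core supports; rows file). [folklore] -/
theorem countP_posRoots_zp_0_17_le (d₁ d₂ d₃ d₄ d₅ : ℕ) (a₀ a₁ a₂ c₀ c₁ c₂ c₃ c₄ c₅ b₀ b₁ b₂ b₃ b₄ : ℝ)
    (hdef : ((((d₃:ℤ) + d₄) - (0:ℤ)) * (((d₃:ℤ) + d₄) - (d₁:ℤ)) * (((d₃:ℤ) + d₄) - (d₂:ℤ)) *
        (((d₃:ℤ) + d₄) - (d₃:ℤ)) * (((d₃:ℤ) + d₄) - (d₄:ℤ)) * (((d₃:ℤ) + d₄) - (d₅:ℤ)) *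
        (((d₃:ℤ) + d₄) - 2 * (d₁:ℤ)) * (((d₃:ℤ) + d₄) - ((d₁:ℤ) + d₂)) * (((d₃:ℤ) + d₄) - ((d₁:ℤ) + d₃)) *
        (((d₃:ℤ) + d₄) - ((d₁:ℤ) + d₄)) * (((d₃:ℤ) + d₄) - ((d₁:ℤ) + d₅)) * (((d₃:ℤ) + d₄) - 2 * (d₂:ℤ)) *
        (((d₃:ℤ) + d₄) - ((d₂:ℤ) + d₃)) * (((d₃:ℤ) + d₄) - ((d₂:ℤ) + d₄)) * (((d₃:ℤ) + d₄) - ((d₂:ℤ) + d₅)))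
      * ((((d₃:ℤ) + d₄) - (0:ℤ)) * (((d₃:ℤ) + d₄) - (d₁:ℤ)) * (((d₃:ℤ) + d₄) - (d₂:ℤ)) * (((d₃:ℤ) + d₄) - (d₃:ℤ)) *
        (((d₃:ℤ) + d₄) - (d₄:ℤ)) * (((d₃:ℤ) + d₄) - (d₅:ℤ)) * (((d₃:ℤ) + d₄) - 2 * (d₁:ℤ)) *
        (((d₃:ℤ) + d₄) - ((d₁:ℤ) + d₂)) * (((d₃:ℤ) + d₄) - ((d₁:ℤ) + d₃)) * (((d₃:ℤ) + d₄) - ((d₁:ℤ) + d₄)) *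
        (((d₃:ℤ) + d₄) - ((d₁:ℤ) + d₅)) * (((d₃:ℤ) + d₄) - 2 * (d₂:ℤ)) * (((d₃:ℤ) + d₄) - ((d₂:ℤ) + d₃)) *
        (((d₃:ℤ) + d₄) - ((d₂:ℤ) + d₄)) * (((d₃:ℤ) + d₄) - ((d₂:ℤ) + d₅)))
      < ((2 * (d₃:ℤ) - (0:ℤ)) * (2 * (d₃:ℤ) - (d₁:ℤ)) * (2 * (d₃:ℤ) - (d₂:ℤ)) * (2 * (d₃:ℤ) - (d₃:ℤ)) *
        (2 * (d₃:ℤ) - (d₄:ℤ)) * (2 * (d₃:ℤ) - (d₅:ℤ)) * (2 * (d₃:ℤ) - 2 * (d₁:ℤ)) * (2 * (d₃:ℤ) - ((d₁:ℤ) + d₂)) *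
        (2 * (d₃:ℤ) - ((d₁:ℤ) + d₃)) * (2 * (d₃:ℤ) - ((d₁:ℤ) + d₄)) * (2 * (d₃:ℤ) - ((d₁:ℤ) + d₅)) *
        (2 * (d₃:ℤ) - 2 * (d₂:ℤ)) * (2 * (d₃:ℤ) - ((d₂:ℤ) + d₃)) * (2 * (d₃:ℤ) - ((d₂:ℤ) + d₄)) *
        (2 * (d₃:ℤ) - ((d₂:ℤ) + d₅)))
      * ((2 * (d₄:ℤ) - (0:ℤ)) * (2 * (d₄:ℤ) - (d₁:ℤ)) * (2 * (d₄:ℤ) - (d₂:ℤ)) * (2 * (d₄:ℤ) - (d₃:ℤ)) *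
        (2 * (d₄:ℤ) - (d₄:ℤ)) * (2 * (d₄:ℤ) - (d₅:ℤ)) * (2 * (d₄:ℤ) - 2 * (d₁:ℤ)) * (2 * (d₄:ℤ) - ((d₁:ℤ) + d₂)) *
        (2 * (d₄:ℤ) - ((d₁:ℤ) + d₃)) * (2 * (d₄:ℤ) - ((d₁:ℤ) + d₄)) * (2 * (d₄:ℤ) - ((d₁:ℤ) + d₅)) *
        (2 * (d₄:ℤ) - 2 * (d₂:ℤ)) * (2 * (d₄:ℤ) - ((d₂:ℤ) + d₃)) * (2 * (d₄:ℤ) - ((d₂:ℤ) + d₄)) *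
        (2 * (d₄:ℤ) - ((d₂:ℤ) + d₅)))) :
    (((C a₀ + C a₁ * X ^ d₁ + C a₂ * X ^ d₂) * (C c₀ + C c₁ * X ^ d₁ + C c₂ * X ^ d₂ + C c₃ * X ^ d₃ + C c₄ * X ^ d₄ + C c₅ * X ^ d₅)
        - (C b₀ + C b₁ * X ^ d₁ + C b₂ * X ^ d₂ + C b₃ * X ^ d₃ + C b₄ * X ^ d₄) ^ 2 : ℝ[X]).roots.countP (fun x => 0 < x)) ≤ 15 := by
  classical
  set e : ℕ → ℕ := fun t => match t with
    | 0 => 2 * d₃ | 1 => d₃ + d₄ | 2 => 2 * d₄ | 3 => 0 | 4 => d₁ | 5 => d₂ | 6 => d₃ | 7 => d₄ | 8 => d₅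
    | 9 => 2 * d₁ | 10 => d₁ + d₂ | 11 => d₁ + d₃ | 12 => d₁ + d₄ | 13 => d₁ + d₅ | 14 => 2 * d₂ | 15 => d₂ + d₃
    | 16 => d₂ + d₄ | 17 => d₂ + d₅ | _ => 0 with he
  set c : ℕ → ℝ := fun t => match t with
    | 0 => -(b₃ ^ 2) | 1 => -((b₃ * b₄ + b₃ * b₄)) | 2 => -(b₄ ^ 2) | 3 => a₀ * c₀ - b₀ ^ 2
    | 4 => a₀ * c₁ + a₁ * c₀ - (b₀ * b₁ + b₀ * b₁) | 5 => a₀ * c₂ + a₂ * c₀ - (b₀ * b₂ + b₀ * b₂)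
    | 6 => a₀ * c₃ - (b₀ * b₃ + b₀ * b₃) | 7 => a₀ * c₄ - (b₀ * b₄ + b₀ * b₄) | 8 => a₀ * c₅ | 9 => a₁ * c₁ - b₁ ^ 2
    | 10 => a₁ * c₂ + a₂ * c₁ - (b₁ * b₂ + b₁ * b₂) | 11 => a₁ * c₃ - (b₁ * b₃ + b₁ * b₃)
    | 12 => a₁ * c₄ - (b₁ * b₄ + b₁ * b₄) | 13 => a₁ * c₅ | 14 => a₂ * c₂ - b₂ ^ 2
    | 15 => a₂ * c₃ - (b₂ * b₃ + b₂ * b₃) | 16 => a₂ * c₄ - (b₂ * b₄ + b₂ * b₄) | 17 => a₂ * c₅ | _ => 0 with hc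
  have hF : ((C a₀ + C a₁ * X ^ d₁ + C a₂ * X ^ d₂) * (C c₀ + C c₁ * X ^ d₁ + C c₂ * X ^ d₂ + C c₃ * X ^ d₃ + C c₄ * X ^ d₄ + C c₅ * X ^ d₅)
        - (C b₀ + C b₁ * X ^ d₁ + C b₂ * X ^ d₂ + C b₃ * X ^ d₃ + C b₄ * X ^ d₄) ^ 2 : ℝ[X])
      = ∑ t ∈ range 18, C (c t) * X ^ (e t) := by
    simp only [Finset.sum_range_succ, Finset.sum_range_zero, zero_add, he, hc, map_mul, map_neg, map_sub,
      map_pow, map_add, pow_add, two_mul, pow_zero, mul_one]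
    ring
  rw [hF]
  have step := countP_posRoots_le_countP_twists 18 e c (Ico 3 18)
  have hcard : (Ico 3 18).card = 15 := by simp
  rw [hcard] at step
  obtain ⟨M, hM⟩ : ∃ M : ℕ → ℝ, ∀ t, M t = ∏ u ∈ Ico 3 18, ((e t : ℝ) - e u) := ⟨_, fun _ => rfl⟩
  have hres : (∑ t ∈ range 18, C (c t * ∏ u ∈ Ico 3 18, ((e t : ℝ) - e u)) * X ^ (e t) : ℝ[X])
      = C (c 0 * M 0) * X ^ (e 0) + C (c 1 * M 1) * X ^ (e 1) + C (c 2 * M 2) * X ^ (e 2) := by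
    rw [Finset.range_eq_Ico, ← Finset.sum_Ico_consecutive _ (show 0 ≤ 3 by norm_num) (show 3 ≤ 18 by norm_num)]
    have hz : (∑ t ∈ Ico 3 18, C (c t * ∏ u ∈ Ico 3 18, ((e t : ℝ) - e u)) * X ^ (e t) : ℝ[X]) = 0 := by
      refine Finset.sum_eq_zero fun t ht => ?_
      rw [Finset.prod_eq_zero ht (sub_self _), mul_zero, map_zero, zero_mul]
    rw [hz, add_zero, Nat.Ico_zero_eq_range]
    simp only [Finset.sum_range_succ, Finset.sum_range_zero, zero_add, ← hM]
  rw [hres] at step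
  have e0 : e 0 = 2 * d₃ := rfl; have e1 : e 1 = d₃ + d₄ := rfl; have e2 : e 2 = 2 * d₄ := rfl
  have c0 : c 0 = -(b₃ ^ 2) := rfl; have c1 : c 1 = -(b₃ * b₄ + b₃ * b₄) := rfl; have c2 : c 2 = -(b₄ ^ 2) := rfl
  rw [e0, e1, e2, c0, c1, c2] at step
  have unroll : ∀ t, M t = ((e t : ℝ) - e 3) * ((e t : ℝ) - e 4) * ((e t : ℝ) - e 5) * ((e t : ℝ) - e 6) *
      ((e t : ℝ) - e 7) * ((e t : ℝ) - e 8) * ((e t : ℝ) - e 9) * ((e t : ℝ) - e 10) * ((e t : ℝ) - e 11) *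
      ((e t : ℝ) - e 12) * ((e t : ℝ) - e 13) * ((e t : ℝ) - e 14) * ((e t : ℝ) - e 15) * ((e t : ℝ) - e 16) *
      ((e t : ℝ) - e 17) := by
    intro t
    rw [hM, Finset.prod_Ico_eq_prod_range]
    simp only [show (18 : ℕ) - 3 = 15 by norm_num, Finset.prod_range_succ, Finset.prod_range_zero, one_mul,
      Nat.reduceAdd]
  have K : M 1 * M 1 < M 0 * M 2 := by
    have h := (Int.cast_lt (R := ℝ)).mpr hdef
    push_cast at h
    simp only [unroll, he]
    push_cast
    exact h
  have res : ((C (-(b₃ ^ 2) * M 0) * X ^ (2 * d₃) + C (-(b₃ * b₄ + b₃ * b₄) * M 1) * X ^ (d₃ + d₄)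
      + C (-(b₄ ^ 2) * M 2) * X ^ (2 * d₄) : ℝ[X]).roots.countP (fun x => 0 < x)) = 0 :=
    countP_posRoots_gramBlock_eq_zero b₃ b₄ (M 0) (M 1) (M 2) K d₃ d₄
  omega


end Summit.ValiantsHypothesis.ValiantsHypothesis.Theorems.LacunarySymmetroidMatrixDescartes.Census
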